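import Mathlib
import Summits.CriticalPhenomena.PercolationContinuityZ3.Theorems.PercNearOneGluingNoHeavyQuantTwoArcPairs
import HarnessLib

/-!
# QUANT lane R8, "FAR beyond trees", layer one on hairy cycles — the one-sided pairs inequality in regime A (all `K`) and the two-sided two-arc lemma (pairs level)

builds on p205010 (kernel theorem, internal audit signed; external expert review pending)

Support file (`--supports stmt-CriticalPhenomena-4575`), seat `prim-quant-p1` (gen 17); memos `quant/prim-quant-p1-g16/FOR-LEAD-TWOCHAIN-A.md` §6′,
`quant/prim-quant-p1-g17/FOR-LEAD-TWOCHAIN-B.md` §2–§3.  Continues `…QuantTwoArcPairs.lean` (vocabulary `Quant.TwoArc.*`, regime-B lemma (ΩB\*)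
`omegaM_nonneg`).  Pure real algebra on lists; no definitions; standard axioms; no sorries.
* `lemmaC` — Lemma C (g16 §5(c)), polynomial form: nearest companion `k`, `(p + A_k)(I_k − e_k) ≥ A_k((σ − 1) + (ρ_k − T_k))`; per later companion
  `(p + A_k) u_l Φ_kl − A_k T_l = A_k((A_l − A_k) c_l u_l + u_l (T_l − x)) + p d_k u_l ≥ 0` (`lemmaC_aux`).
* `pairs_two_of_half_lt` — two companions, `x > 1/2`: `Π − ℬ ≥ x` (odds lowered to the ties; g16's tied identity
  `G = (2x−1)(d_2 + A_2Δ) + d_2 c_3 (p − A_2) + A_2 (A_3 − A_2) c_2 c_3 ≥ 0`).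
* `pairs_regimeA` — **(P1) IN REGIME A for every number of companions** (g16 §6′, new route): `0 ≤ p ≤ 1`, `c₁ ≤ 1`, a non-empty nearest-first admissible
  list, `A` non-decreasing, `c` non-increasing, `σ ≥ 1` ⟹ `x ≤ Π − ℬ`.  Induction removing the nearest companion `k`: supercritical rest ⟹ `Π − ℬ` grows by
  `u_k C_k ≥ 0` (Lemma C); subcritical rest ⟹ (ΩB\*) for the rest and `(1−x) u_k C_k − (1−σ')C = u_k (Q₀ + (T_k − x)(C − e_k) + s e_k) + s C`
  (`s = σ − 1`, `Q₀ ≥ 0` by `tied_removal_aux`, needing `p ≥ A_k` — automatic except two companions with `x > 1/2`, = `pairs_two_of_half_lt`).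
* `u_phi_ge_e` (`u_j Φ_jk ≥ e_k` for a nearer finite `j`), `inc_nonneg`, `piS_nonneg` (pair values `≥ 0`).
* `twoSided_pairs` — **THE TWO-SIDED TWO-ARC LEMMA, pairs level**: left companions `L` (system `(p_L, p_R)`), right `R` (system `(p_R, p_L)`), non-empty,
  admissible, ordered, `σ_L + σ_R ≥ 1` ⟹ `(1−x)(Ω_L + Ω_R − x) + P_L P_R ≥ 0`, `x = 1 − p_L p_R`, `Ω = Π − ℬ`, `P = σ + E + ℬ` (cross term
  `C = P_L P_R/(1−x)`, g16 (γ′)): `pairs_regimeA` + `twoSided_coupling_super`, or `omegaM_nonneg` ×2 + `twoSided_coupling`.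
With the pairs lower bound `P(N ≥ 2) − x ≥ Σ_{|Q| ≤ 2} w(Q)Φ(Q)` (next file, over prim-cert-1's `sunLaw`) this is TC-MC regime A for a SURE distinguished relay
at every position, hence FAR at layer one on every hairy cycle whose least likely relay stays least likely with its hair made sure.  NOT here: that bridge;
the tied-random relay (open, memo §5).  Exact re-check of every identity: memo `num/proofcheck_omb.py`.  Prior art: as in `…QuantTwoArcPairs`; [this work].
-/

namespace Summit.CriticalPhenomena.PercolationContinuityZ3.Theorems

namespace Quant

namespace TwoArc

variable {p c₁ : ℝ}

/-! ## Lemma C (g16 §5(c)) in polynomial form and the one-sided regime-A pairs inequality (P1) -/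

/-- Lemma C, summed core: for the nearest companion `k` and admissible later companions with prefix drops `≥ A_k`,
`A_k · σ' ≤ (p + A_k) · I_k` (per companion: `(p + A_k) u_l (d_k + A_k Δ_l) − A_k T_l = A_k((A_l − A_k) c_l u_l + u_l (T_l − x)) + p d_k u_l ≥ 0`). [this work] -/
theorem lemmaC_aux (k : Comp) (hkA : 0 ≤ k.A) (hp : 0 ≤ p) (hd : 0 ≤ k.d p c₁)
    (ks : List Comp) (h : ∀ l ∈ ks, Comp.Adm p c₁ l) (hA : ∀ l ∈ ks, k.A ≤ l.A) :
    k.A * sigS ks ≤ (p + k.A) * inc p c₁ k ks := by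
  induction ks with
  | nil => simp
  | cons l ls ih =>
    have hl := h l (by simp)
    have hAl := hA l (by simp)
    have ih' := ih (fun m hm => h m (by simp [hm])) (fun m hm => hA m (by simp [hm]))
    have hodds := hl.odds
    have hid : (p + k.A) * (l.u * Comp.phi p c₁ k l) - k.A * l.T
        = k.A * ((l.A - k.A) * l.c * l.u + l.u * (l.T - xv p c₁)) + p * k.d p c₁ * l.u := by
      simp only [Comp.phi, Comp.d, Comp.rho, xv] at hodds ⊢
      linear_combination k.A * hodds
    have h1 : 0 ≤ k.A * ((l.A - k.A) * l.c * l.u + l.u * (l.T - xv p c₁)) :=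
      mul_nonneg hkA (add_nonneg (mul_nonneg (mul_nonneg (by linarith) hl.c_nonneg) hl.u_nonneg)
        (mul_nonneg hl.u_nonneg (by linarith [hl.x_le_T])))
    have h2 : 0 ≤ p * k.d p c₁ * l.u := mul_nonneg (mul_nonneg hp hd) hl.u_nonneg
    rw [sigS_cons, inc_cons]
    nlinarith [hid, h1, h2, ih']

/-- **Lemma C** (g16): the coefficient of `u_k` in the pairs polynomial, `C_k = I_k − e_k`, satisfies
`(p + A_k)·(I_k − e_k) ≥ A_k·((σ − 1) + (ρ_k − T_k))`; in particular `C_k ≥ 0` in regime A (`σ ≥ 1`). [this work] -/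
theorem lemmaC (k : Comp) (hkA : 0 ≤ k.A) (hd : 0 ≤ k.d p c₁) (hp : 0 ≤ p)
    (ks : List Comp) (h : ∀ l ∈ ks, Comp.Adm p c₁ l) (hA : ∀ l ∈ ks, k.A ≤ l.A) :
    k.A * ((k.T + sigS ks - 1) + (k.rho p - k.T)) ≤ (p + k.A) * (inc p c₁ k ks - k.e) := by
  have haux := lemmaC_aux k hkA hp hd ks h hA
  have : (p + k.A) * k.e = k.A * (1 - k.rho p) := by simp only [Comp.e, Comp.rho]; ring
  nlinarith [haux, this]

/-- Positivity of `p + A_k`: an admissible companion forces `x < 1`, hence `p > 0`. [this work] -/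
theorem p_add_A_pos (hp : 0 ≤ p) (k : Comp) (hk : Comp.Adm p c₁ k) : 0 < p + k.A := by
  by_contra hq
  have hA0 : k.A = 0 := by linarith [hk.A_nonneg]
  have hp0 : p = 0 := by linarith [hk.A_nonneg]
  have h1 := hk.odds; have h2 := hk.x_le_T; have h3 := hk.T_le_rho
  simp only [Comp.rho, xv, hA0, hp0, zero_add, zero_mul, sub_zero] at h1 h2 h3
  have hT : k.T = 1 := le_antisymm h3 h2
  rw [hT] at h1
  norm_num at h1

/-- The two-companion regime-A case with `x > 1/2` (then `σ = T_2 + T_3 > 1` automatically): `Π − ℬ ≥ x`, by pushing both odds down to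
their ties (coefficients `C_2 ≥ 0` by Lemma C, `x(d_2 + A_2Δ) − d_2 e_3 ≥ 0`) and the tied inequality
`G = (2x−1)(d_2 + A_2Δ) + d_2 c_3 (p − A_2) + A_2 (A_3 − A_2) c_2 c_3 ≥ 0` (if `A_2 > p` use `c_3(A_2 − p) ≤ 2x − 1`). (g16 §6′ STEP 3(i).) [this work] -/
theorem pairs_two_of_half_lt (hp : 0 ≤ p) (hc₁1 : c₁ ≤ 1) (k l : Comp) (hk : Comp.Adm p c₁ k) (hl : Comp.Adm p c₁ l)
    (hA : k.A ≤ l.A) (hc : l.c ≤ k.c) (hx : 1 / 2 < xv p c₁) :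
    xv p c₁ ≤ piS p c₁ [k, l] - bS [k, l] := by
  have hxk := hk.x_le_T; have hxl := hl.x_le_T
  have hok := hk.odds; have hol := hl.odds
  have hrk := hk.T_le_rho; have hrl := hl.T_le_rho
  -- d's are nonneg, and u d ≥ T ≥ x
  have hdk : 0 ≤ k.d p c₁ := by simp only [Comp.d, Comp.rho, xv] at *; linarith
  have hdl : 0 ≤ l.d p c₁ := by simp only [Comp.d, Comp.rho, xv] at *; linarith
  have hudk : k.T ≤ k.u * k.d p c₁ := by
    have : k.u * k.d p c₁ = k.T + k.u * (k.T - xv p c₁) := by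
      simp only [Comp.d, Comp.rho, xv] at hok ⊢; linear_combination hok
    nlinarith [hk.u_nonneg]
  have hudl : l.T ≤ l.u * l.d p c₁ := by
    have : l.u * l.d p c₁ = l.T + l.u * (l.T - xv p c₁) := by
      simp only [Comp.d, Comp.rho, xv] at hol ⊢; linear_combination hol
    nlinarith [hl.u_nonneg]
  -- Lemma C for the pair: C_2 = u_3 Φ_23 − e_2 ≥ 0 (σ = T_2 + T_3 ≥ 2x > 1)
  have hC := lemmaC k hk.A_nonneg hdk hp [l] (by intro m hm; simp at hm; subst hm; exact hl)
    (by intro m hm; simp at hm; subst hm; exact hA)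
  simp only [sigS_cons, sigS_nil, inc_cons, inc_nil, add_zero] at hC
  have hq := p_add_A_pos hp k hk
  have hC2 : 0 ≤ l.u * Comp.phi p c₁ k l - k.e := by
    have : 0 ≤ k.A * ((k.T + l.T - 1) + (k.rho p - k.T)) := mul_nonneg hk.A_nonneg (by linarith)
    nlinarith
  simp only [piS_cons, piS_nil, inc_cons, inc_nil, bS_cons, bS_nil, add_zero, zero_add]
  -- Step 1: lower u_2 to its tie:  d_2 (Π − ℬ − x) ≥ x C_2 − d_2 u_3 e_3 − d_2 x
  have step1 : xv p c₁ * (l.u * Comp.phi p c₁ k l - k.e) - k.d p c₁ * (l.u * l.e) - k.d p c₁ * xv p c₁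
      ≤ k.d p c₁ * (k.u * (l.u * Comp.phi p c₁ k l) - (k.u * k.e + l.u * l.e) - xv p c₁) := by
    nlinarith [mul_le_mul_of_nonneg_right hudk hC2, hC2, hxk]
  -- Step 2: the coefficient of u_3 after step 1 is κ = x(d_2 + A_2 Δ) − d_2 e_3 ≥ 0
  have hxe3 : l.e ≤ xv p c₁ := by
    have : l.A * l.c ≤ (1 - p) * c₁ := by nlinarith [hl.A_le, hl.c_le, hl.A_nonneg, hl.c_nonneg]
    simp only [Comp.e, xv] at this ⊢; nlinarith
  have hkap : 0 ≤ xv p c₁ * (k.d p c₁ + k.A * (k.c - l.c)) - k.d p c₁ * l.e := by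
    have : 0 ≤ k.A * (k.c - l.c) := mul_nonneg hk.A_nonneg (by linarith)
    nlinarith [mul_nonneg hdk (sub_nonneg.2 hxe3)]
  have step2 : xv p c₁ * (xv p c₁ * (k.d p c₁ + k.A * (k.c - l.c)) - k.d p c₁ * l.e) - l.d p c₁ * xv p c₁ * (k.e + k.d p c₁)
      ≤ l.d p c₁ * (xv p c₁ * (l.u * Comp.phi p c₁ k l - k.e) - k.d p c₁ * (l.u * l.e) - k.d p c₁ * xv p c₁) := by
    have hphi : Comp.phi p c₁ k l = k.d p c₁ + k.A * (k.c - l.c) := rfl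
    rw [hphi]
    nlinarith [mul_le_mul_of_nonneg_right hudl hkap, hkap, hxl]
  -- Step 3: the tied value G ≥ 0, via g16's form G = (2x−1)(d_2 + A_2Δ) + d_2 c_3 (p − A_2) + A_2 (A_3 − A_2) c_2 c_3
  have hG : 0 ≤ xv p c₁ * (k.d p c₁ + k.A * (k.c - l.c)) - k.d p c₁ * l.e - l.d p c₁ * (k.e + k.d p c₁) := by
    have hGid : xv p c₁ * (k.d p c₁ + k.A * (k.c - l.c)) - k.d p c₁ * l.e - l.d p c₁ * (k.e + k.d p c₁)
        = (2 * xv p c₁ - 1) * (k.d p c₁ + k.A * (k.c - l.c)) + k.d p c₁ * l.c * (p - k.A)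
          + k.A * (l.A - k.A) * k.c * l.c := by
      simp only [Comp.d, Comp.e, xv]; ring
    rw [hGid]
    have hx2 : 0 ≤ 2 * xv p c₁ - 1 := by linarith
    have hΔ : 0 ≤ k.d p c₁ + k.A * (k.c - l.c) := add_nonneg hdk (mul_nonneg hk.A_nonneg (by linarith))
    have h3 : 0 ≤ k.A * (l.A - k.A) * k.c * l.c :=
      mul_nonneg (mul_nonneg (mul_nonneg hk.A_nonneg (by linarith)) hk.c_nonneg) hl.c_nonneg
    by_cases hpA : k.A ≤ p
    · have h2 : 0 ≤ k.d p c₁ * l.c * (p - k.A) := mul_nonneg (mul_nonneg hdk hl.c_nonneg) (by linarith)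
      linarith [mul_nonneg hx2 hΔ, h2, h3]
    · -- A_2 > p:  l.c (A_2 − p) ≤ c₁ (1 − 2p) ≤ 2x − 1, so the middle term is ≥ −d_2 (2x − 1)
      have hpA' : p ≤ k.A := le_of_lt (not_le.mp hpA)
      have hc₁0 : 0 ≤ c₁ := le_trans hl.c_nonneg hl.c_le
      have h1a : l.c * (k.A - p) ≤ c₁ * (k.A - p) := mul_le_mul_of_nonneg_right hl.c_le (by linarith)
      have h1b : c₁ * (k.A - p) ≤ c₁ * (1 - 2 * p) := mul_le_mul_of_nonneg_left (by linarith [hk.A_le]) hc₁0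
      have h1c : c₁ * (1 - 2 * p) ≤ 2 * xv p c₁ - 1 := by
        have : c₁ * (1 - 2 * p) = c₁ - 2 * (p * c₁) := by ring
        simp only [xv]; linarith
      have h1 : l.c * (k.A - p) ≤ 2 * xv p c₁ - 1 := by linarith
      have h2 := mul_le_mul_of_nonneg_left h1 hdk
      have e1 : k.d p c₁ * l.c * (p - k.A) = -(k.d p c₁ * (l.c * (k.A - p))) := by ring
      have e2 : (2 * xv p c₁ - 1) * (k.d p c₁ + k.A * (k.c - l.c))
          = k.d p c₁ * (2 * xv p c₁ - 1) + (2 * xv p c₁ - 1) * (k.A * (k.c - l.c)) := by ring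
      have h4 : 0 ≤ (2 * xv p c₁ - 1) * (k.A * (k.c - l.c)) := mul_nonneg hx2 (mul_nonneg hk.A_nonneg (by linarith))
      linarith [h2, h3, h4, e1, e2]
  -- positivity of d's (strict): from x > 1/2 > 0 and the odds relation
  have hx0 : 0 < xv p c₁ := by linarith
  by_cases hdk0 : k.d p c₁ = 0
  · exfalso
    have hT : k.T = k.rho p := by simp only [Comp.d, Comp.rho, xv] at hdk0 hxk hrk ⊢; linarith
    have : k.rho p = 0 := by rw [hT, sub_self, mul_zero] at hok; linarith
    linarith
  by_cases hdl0 : l.d p c₁ = 0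
  · exfalso
    have hT : l.T = l.rho p := by simp only [Comp.d, Comp.rho, xv] at hdl0 hxl hrl ⊢; linarith
    have : l.rho p = 0 := by rw [hT, sub_self, mul_zero] at hol; linarith
    linarith
  have hdk' : 0 < k.d p c₁ := lt_of_le_of_ne hdk (Ne.symm hdk0)
  have hdl' : 0 < l.d p c₁ := lt_of_le_of_ne hdl (Ne.symm hdl0)
  -- combine: d_2 d_3 (Π − ℬ − x) ≥ x G ≥ 0
  have e : xv p c₁ * (xv p c₁ * (k.d p c₁ + k.A * (k.c - l.c)) - k.d p c₁ * l.e) - l.d p c₁ * xv p c₁ * (k.e + k.d p c₁)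
      = xv p c₁ * (xv p c₁ * (k.d p c₁ + k.A * (k.c - l.c)) - k.d p c₁ * l.e - l.d p c₁ * (k.e + k.d p c₁)) := by ring
  have h5 := mul_le_mul_of_nonneg_left step1 hdl
  have hV : 0 ≤ (k.d p c₁ * l.d p c₁) * (k.u * (l.u * Comp.phi p c₁ k l) - (k.u * k.e + l.u * l.e) - xv p c₁) := by
    have e3 : (k.d p c₁ * l.d p c₁) * (k.u * (l.u * Comp.phi p c₁ k l) - (k.u * k.e + l.u * l.e) - xv p c₁)
        = l.d p c₁ * (k.d p c₁ * (k.u * (l.u * Comp.phi p c₁ k l) - (k.u * k.e + l.u * l.e) - xv p c₁)) := by ring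
    have h6 := mul_nonneg hx0.le hG
    linarith [h6, step2, h5, e, e3]
  have hVnn := (mul_nonneg_iff_of_pos_left (mul_pos hdk' hdl')).mp hV
  linarith [hVnn]

/-- An admissible companion has `T < 1` (its hair odds are finite). [this work] -/
theorem T_lt_one (hp : 0 ≤ p) (k : Comp) (hk : Comp.Adm p c₁ k) : k.T < 1 := by
  by_contra h
  have h1 : 1 ≤ k.T := not_lt.mp h
  have hrho : k.rho p ≤ 1 := by
    have : 0 ≤ (p + k.A) * k.c := mul_nonneg (by linarith [hk.A_nonneg]) hk.c_nonneg
    simp only [Comp.rho]; linarith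
  have h2 : k.u * (k.rho p - k.T) ≤ 0 := mul_nonpos_of_nonneg_of_nonpos hk.u_nonneg (by linarith)
  linarith [hk.odds]

/-- `x ≤ 1/2` forces `A ≤ p` for every admissible companion (`p ≥ p c₁ = 1 − x ≥ 1/2 ≥ 1 − p ≥ A`). [this work] -/
theorem A_le_p_of_x_le_half (hp : 0 ≤ p) (hc₁1 : c₁ ≤ 1) (k : Comp) (hk : Comp.Adm p c₁ k) (hx : xv p c₁ ≤ 1 / 2) :
    k.A ≤ p := by
  simp only [xv] at hx
  have : p * c₁ ≤ p := by nlinarith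
  linarith [hk.A_le]

/-- **The one-sided pairs inequality in regime A** (g16 §6′ (P1), all `K`; new proof): for `0 ≤ p ≤ 1`, `c₁ ≤ 1`, a non-empty nearest-first
list of admissible companions with `A` non-decreasing and `c` non-increasing, and `σ ≥ 1`:  `x ≤ Π − ℬ`.
PROOF: induction removing the nearest companion `k`.  If the rest is still supercritical, `Π − ℬ` grows by `u_k C_k ≥ 0` (Lemma C).  If the rest
is subcritical, (ΩB\*) for the rest and the identity `(1−x)u_k C_k − (1−σ')C = u_k(Q₀ + (T_k−x)(C−e_k) + s e_k) + s C` (`s = σ − 1`,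
`Q₀ ≥ 0` by `tied_removal_aux`, which needs `p ≥ A_k`, automatic unless there are exactly two companions and `x > 1/2` — that case is
`pairs_two_of_half_lt`). [this work] -/
theorem pairs_regimeA (hp : 0 ≤ p) (hp1 : p ≤ 1) (hc₁1 : c₁ ≤ 1) :
    ∀ (ks : List Comp), ks ≠ [] → (∀ k ∈ ks, Comp.Adm p c₁ k) → ks.Pairwise (fun j k => j.A ≤ k.A) →
      ks.Pairwise (fun j k => k.c ≤ j.c) → 1 ≤ sigS ks → xv p c₁ ≤ piS p c₁ ks - bS ks := by
  intro ks
  induction ks with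
  | nil => intro h; exact absurd rfl h
  | cons k ks ih =>
    intro _ hadm hpwA hpwc hσ
    have hk := hadm k (by simp)
    have hx0 : 0 ≤ xv p c₁ := by simp only [xv]; nlinarith
    have hTk := T_lt_one hp k hk
    rcases List.pairwise_cons.mp hpwA with ⟨hkA, hpwA'⟩
    rcases List.pairwise_cons.mp hpwc with ⟨hkc, hpwc'⟩
    by_cases hks : ks = []
    · subst hks; simp only [sigS_cons, sigS_nil, add_zero] at hσ; linarith
    have hadm' : ∀ l ∈ ks, Comp.Adm p c₁ l := fun l hl => hadm l (by simp [hl])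
    obtain ⟨l, ls, rfl⟩ := List.exists_cons_of_ne_nil hks
    have hl := hadm' l (by simp)
    rw [sigS_cons] at hσ
    have hrec : piS p c₁ (k :: l :: ls) - bS (k :: l :: ls)
        = (piS p c₁ (l :: ls) - bS (l :: ls)) + k.u * (inc p c₁ k (l :: ls) - k.e) := by
      rw [piS_cons, bS_cons]; ring
    have hq := p_add_A_pos hp k hk
    have hd : 0 ≤ k.d p c₁ := by
      have := hk.T_le_rho; have := hk.x_le_T; simp only [Comp.d, Comp.rho, xv] at *; linarith
    by_cases hσ' : 1 ≤ sigS (l :: ls)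
    · -- supercritical rest: Lemma C
      have ih' := ih hks hadm' hpwA' hpwc' hσ'
      have hC := lemmaC k hk.A_nonneg hd hp (l :: ls) hadm' hkA
      have hC0 : 0 ≤ inc p c₁ k (l :: ls) - k.e := by
        have : 0 ≤ k.A * ((k.T + sigS (l :: ls) - 1) + (k.rho p - k.T)) :=
          mul_nonneg hk.A_nonneg (by linarith [hk.T_le_rho])
        exact (mul_nonneg_iff_of_pos_left hq).mp (le_trans this hC)
      rw [hrec]; nlinarith [mul_nonneg hk.u_nonneg hC0]
    · -- subcritical rest
      rw [not_le] at hσ'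
      by_cases hpA : k.A ≤ p
      swap
      · -- then x > 1/2 and ls = [] : the two-companion lemma
        have hx : 1 / 2 < xv p c₁ := by
          by_contra hx; exact hpA (A_le_p_of_x_le_half hp hc₁1 k hk (not_lt.mp hx))
        have hls : ls = [] := by
          by_contra hne
          obtain ⟨m, ms, rfl⟩ := List.exists_cons_of_ne_nil hne
          have hm := hadm' m (by simp)
          have := (sigS_ge (ks := ms) (fun n hn => hadm' n (by simp [hn])) hx0).1
          rw [sigS_cons, sigS_cons] at hσ'
          linarith [hl.x_le_T, hm.x_le_T]
        subst hls
        exact pairs_two_of_half_lt hp hc₁1 k l hk hl (hkA l (by simp)) (hkc l (by simp)) hx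
      have hM := omegaM_nonneg hp hp1 hc₁1 (l :: ls) hks hadm' hpwA' hσ'.le
      have haux := tied_removal_aux k hk.A_nonneg hk.c_nonneg hpA hd (l :: ls) hadm' hkA
      have hsig := sigS_ge (ks := l :: ls) hadm' hx0
      have hσx : xv p c₁ ≤ sigS (l :: ls) := hsig.2 (by simp)
      have hB := bS_nonneg (ks := l :: ls) hadm'
      have hE := eS_nonneg (ks := l :: ls) hadm'
      have hex : k.e ≤ xv p c₁ := by
        have : k.A * k.c ≤ (1 - p) * c₁ := by nlinarith [hk.A_le, hk.c_le, hk.A_nonneg, hk.c_nonneg]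
        simp only [Comp.e, xv]; nlinarith
      set I := inc p c₁ k (l :: ls) with hI
      set σ' := sigS (l :: ls) with hσ'def
      set B' := bS (l :: ls) with hB'
      set E' := eS p c₁ (l :: ls) with hE'
      set C := xv p c₁ + B' + E' with hCdef
      have hM' : (1 - xv p c₁) * (piS p c₁ (l :: ls) - B' - xv p c₁) = omegaM p c₁ (l :: ls) - (1 - σ') * C := by
        simp only [omegaM, hCdef, hσ'def, hB', hE']; ring
      have hkey : (1 - xv p c₁) * (k.u * (I - k.e)) - (1 - σ') * C
          = k.u * (((1 - xv p c₁) * I - σ' * k.e - k.d p c₁ * C) + (k.T - xv p c₁) * (C - k.e) + (k.T + σ' - 1) * k.e)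
            + (k.T + σ' - 1) * C := by
        have h := hk.odds
        simp only [Comp.d, Comp.rho, xv] at h ⊢
        linear_combination C * h
      have hQ0 : 0 ≤ (1 - xv p c₁) * I - σ' * k.e - k.d p c₁ * C := by
        have : k.d p c₁ * xv p c₁ ≤ k.d p c₁ * σ' := mul_le_mul_of_nonneg_left hσx hd
        simp only [hCdef]; nlinarith [haux, this]
      have hin : 0 ≤ ((1 - xv p c₁) * I - σ' * k.e - k.d p c₁ * C) + (k.T - xv p c₁) * (C - k.e) + (k.T + σ' - 1) * k.e := by
        have h1 : 0 ≤ (k.T - xv p c₁) * (C - k.e) := mul_nonneg (by linarith [hk.x_le_T]) (by simp only [hCdef]; linarith)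
        have h2 : 0 ≤ (k.T + σ' - 1) * k.e := mul_nonneg (by linarith) (mul_nonneg hk.A_nonneg hk.c_nonneg)
        linarith
      have hsC : 0 ≤ (k.T + σ' - 1) * C := mul_nonneg (by linarith) (by simp only [hCdef]; linarith)
      have hprod : 0 ≤ (1 - xv p c₁) * (piS p c₁ (k :: l :: ls) - bS (k :: l :: ls) - xv p c₁) := by
        have e1 : (1 - xv p c₁) * (piS p c₁ (k :: l :: ls) - bS (k :: l :: ls) - xv p c₁)
            = (1 - xv p c₁) * (piS p c₁ (l :: ls) - B' - xv p c₁) + (1 - xv p c₁) * (k.u * (I - k.e)) := by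
          rw [hrec]; simp only [hB', hI]; ring
        rw [e1, hM']
        nlinarith [mul_nonneg hk.u_nonneg hin, hkey, hsC, hM]
      have h1x : 0 < 1 - xv p c₁ := by linarith [hk.x_le_T]
      have := (mul_nonneg_iff_of_pos_left h1x).mp hprod
      linarith

/-- A finite admissible companion `j` nearer than `k` pays `k`'s singleton: `u_j Φ_jk ≥ e_k` (`u_j Φ_jk ≥ u_j d_j ≥ T_j ≥ x ≥ e_k`). With Lemma C
this gives the non-negativity of every coefficient `C_k` of the pairs polynomial in regime A (g16 STEP 2), used when companion `k` is sure. [this work] -/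
theorem u_phi_ge_e (hp1 : p ≤ 1) (hc₁1 : c₁ ≤ 1) (j k : Comp) (hj : Comp.Adm p c₁ j)
    (hkA1 : k.A ≤ 1 - p) (hkc : 0 ≤ k.c) (hkc1 : k.c ≤ c₁) (hc : k.c ≤ j.c) :
    k.e ≤ j.u * Comp.phi p c₁ j k := by
  have hoj := hj.odds; have hxj := hj.x_le_T; have hrj := hj.T_le_rho
  have hdj : 0 ≤ j.d p c₁ := by simp only [Comp.d, Comp.rho, xv] at *; linarith
  have hud : j.T ≤ j.u * j.d p c₁ := by
    have : j.u * j.d p c₁ = j.T + j.u * (j.T - xv p c₁) := by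
      simp only [Comp.d, Comp.rho, xv] at hoj ⊢; linear_combination hoj
    nlinarith [hj.u_nonneg]
  have hex : k.e ≤ xv p c₁ := by
    have : k.A * k.c ≤ (1 - p) * c₁ := by nlinarith
    simp only [Comp.e, xv]; nlinarith
  have : j.u * j.d p c₁ ≤ j.u * Comp.phi p c₁ j k :=
    mul_le_mul_of_nonneg_left (by simp only [Comp.phi]; nlinarith [hj.A_nonneg]) hj.u_nonneg
  linarith

/-! ## Two-sided assembly (memo §2): right companions = system `(p_R, p_L) = (1 − α_i, 1 − β_i)`, left (mirrored) = system `(p_L, p_R)`;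
both have `x = 1 − p_L p_R`; the two-sided pairs polynomial is `Ω_L + Ω_R + P_L P_R/(1 − x)`, `Ω = Π − ℬ`, `P = σ + E + ℬ`. -/

/-- Pair incomes are non-negative when the suffix failures do not increase along the list (`Φ_kl = d_k + A_k (c_k − c_l) ≥ 0`). [this work] -/
theorem inc_nonneg (k : Comp) (hkA : 0 ≤ k.A) (hd : 0 ≤ k.d p c₁) (ks : List Comp) (h : ∀ l ∈ ks, Comp.Adm p c₁ l)
    (hc : ∀ l ∈ ks, l.c ≤ k.c) : 0 ≤ inc p c₁ k ks := by
  induction ks with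
  | nil => simp
  | cons l ls ih =>
    rw [inc_cons]
    have hl := h l (by simp)
    have := ih (fun m hm => h m (by simp [hm])) (fun m hm => hc m (by simp [hm]))
    have : 0 ≤ l.u * Comp.phi p c₁ k l :=
      mul_nonneg hl.u_nonneg (add_nonneg hd (mul_nonneg hkA (by linarith [hc l (by simp)])))
    linarith

/-- `Π ≥ 0` for an admissible nearest-first list with non-increasing suffix failures. [this work] -/
theorem piS_nonneg {ks : List Comp} (h : ∀ k ∈ ks, Comp.Adm p c₁ k) (hc : ks.Pairwise (fun j k => k.c ≤ j.c)) :
    0 ≤ piS p c₁ ks := by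
  induction ks with
  | nil => simp
  | cons k ks ih =>
    rw [piS_cons]
    have hk := h k (by simp)
    rcases List.pairwise_cons.mp hc with ⟨hkc, hc'⟩
    have hd : 0 ≤ k.d p c₁ := by
      have := hk.T_le_rho; have := hk.x_le_T; simp only [Comp.d, Comp.rho, xv] at *; linarith
    have h1 := ih (fun l hl => h l (by simp [hl])) hc'
    have h2 := inc_nonneg k hk.A_nonneg hd ks (fun l hl => h l (by simp [hl])) hkc
    nlinarith [mul_nonneg hk.u_nonneg h2]

/-- The two parameterisations of the two sides give the same `x = 1 − p_L p_R`. [this work] -/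
theorem xv_comm (pL pR : ℝ) : xv pL pR = xv pR pL := by simp only [xv]; ring

/-- **THE TWO-SIDED TWO-ARC LEMMA at the pairs level** (memo §2; with g16 §6′ this is TC-MC regime A for a sure distinguished relay at every
position).  Left companions `L` (a one-sided system with parameters `(p_L, p_R)`), right companions `R` (parameters `(p_R, p_L)`), both non-empty,
admissible, `A` non-decreasing and `c` non-increasing along each list, and total mass `σ_L + σ_R ≥ 1`.  Then, with `x = 1 − p_L p_R`,
`Ω_S = Π_S − ℬ_S`, `P_S = σ_S + E_S + ℬ_S`:   `(1 − x)(Ω_L + Ω_R − x) + P_L P_R ≥ 0`, i.e. `Ω_L + Ω_R + P_L P_R/(1−x) ≥ x`. [this work] -/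
theorem twoSided_pairs (pL pR : ℝ) (hpL : 0 ≤ pL) (hpL1 : pL ≤ 1) (hpR : 0 ≤ pR) (hpR1 : pR ≤ 1)
    (L R : List Comp) (hLne : L ≠ []) (hRne : R ≠ [])
    (admL : ∀ k ∈ L, Comp.Adm pL pR k) (admR : ∀ k ∈ R, Comp.Adm pR pL k)
    (hAL : L.Pairwise (fun j k => j.A ≤ k.A)) (hcL : L.Pairwise (fun j k => k.c ≤ j.c))
    (hAR : R.Pairwise (fun j k => j.A ≤ k.A)) (hcR : R.Pairwise (fun j k => k.c ≤ j.c))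
    (hσ : 1 ≤ sigS L + sigS R) :
    0 ≤ (1 - xv pL pR) * ((piS pL pR L - bS L) + (piS pR pL R - bS R) - xv pL pR)
        + (sigS L + eS pL pR L + bS L) * (sigS R + eS pR pL R + bS R) := by
  have hx0 : 0 ≤ xv pL pR := by simp only [xv]; nlinarith
  have hx1 : xv pL pR ≤ 1 := by simp only [xv]; nlinarith
  have hxc := xv_comm pL pR
  have hBL := bS_nonneg admL; have hBR := bS_nonneg admR
  have hEL := eS_nonneg admL; have hER := eS_nonneg admR
  have hPiL := piS_nonneg admL hcL; have hPiR := piS_nonneg admR hcR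
  have hsL := sigS_ge admL hx0; have hsR := sigS_ge admR (by rw [← hxc]; exact hx0)
  have hxL := hsL.2 hLne; have hxR := hsR.2 hRne
  rw [← hxc] at hxR
  by_cases hR1 : 1 ≤ sigS R
  · have hΩR := pairs_regimeA hpR hpR1 hpL1 R hRne admR hAR hcR hR1
    rw [← hxc] at hΩR
    have := twoSided_coupling_super (x := xv pL pR) (PiL := piS pL pR L) (BL := bS L)
      (PL := sigS L + eS pL pR L + bS L) (PR := sigS R + eS pR pL R + bS R) (ΩR := piS pR pL R - bS R)
      hx0 hx1 hΩR (by linarith) hPiL hBL (by linarith [hsL.1])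
    nlinarith [this]
  by_cases hL1 : 1 ≤ sigS L
  · have hΩL := pairs_regimeA hpL hpL1 hpR1 L hLne admL hAL hcL hL1
    have := twoSided_coupling_super (x := xv pL pR) (PiL := piS pR pL R) (BL := bS R)
      (PL := sigS R + eS pR pL R + bS R) (PR := sigS L + eS pL pR L + bS L) (ΩR := piS pL pR L - bS L)
      hx0 hx1 hΩL (by linarith) hPiR hBR (by linarith [hsR.1])
    nlinarith [this]
  rw [not_le] at hR1 hL1
  have hML := omegaM_nonneg hpL hpL1 hpR1 L hLne admL hAL hL1.le
  have hMR := omegaM_nonneg hpR hpR1 hpL1 R hRne admR hAR hR1.le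
  have eL : omegaM pL pR L = (1 - xv pL pR) * ((piS pL pR L - bS L) - xv pL pR)
      + (1 - sigS L) * ((sigS L + eS pL pR L + bS L) - sigS L + xv pL pR) := by simp only [omegaM]; ring
  have eR : omegaM pR pL R = (1 - xv pL pR) * ((piS pR pL R - bS R) - xv pL pR)
      + (1 - sigS R) * ((sigS R + eS pR pL R + bS R) - sigS R + xv pL pR) := by simp only [omegaM, hxc]; ring
  have := twoSided_coupling (x := xv pL pR) (σL := sigS L) (σR := sigS R)
    (PL := sigS L + eS pL pR L + bS L) (PR := sigS R + eS pR pL R + bS R)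
    (ΩL := piS pL pR L - bS L) (ΩR := piS pR pL R - bS R)
    hx0 (by rw [← eL]; exact hML) (by rw [← eR]; exact hMR) (by linarith) (by linarith) hxL hxR hL1.le hR1.le hσ
  linarith [this]

end TwoArc

end Quant

end Summit.CriticalPhenomena.PercolationContinuityZ3.Theorems
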